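import Summits.QuantumFields.YangMills.Theorems.ColdExitSC.Negative.UniformExitFalseOfHeavyTwistWindow
import Summits.QuantumFields.YangMills.Theorems.BalabanLadderIRHeavyTwistWall
import Summits.QuantumFields.YangMills.Theorems.BrascampLiebVacuumSC.Negative.AdmissibleInstance

/-!
# The β-UNIFORM exit form of the seed of record at `SU(2)` is FALSE — unconditional headline of the heavy-twist wall (file 4)

Joins three landed pieces BY NAME: the Window file's parity-free RUNG 2 `not_uniformExit24_of_window`
(`TwistWindowSU2 κ (9/10) → SimplyConnectedSpace SU(2) → ¬ UniformExit24`; ym-ir-idea-10, S1 from ym-ir-idea-9's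
`TwistCost.half_twist_cost_le_coldDefect`, parity closure from `BasinRung.basin_step24`), the wall seat's window theorem
`HeavyTwistWall.twistWindow_SU2` (ym-ir-wall-p1 W1–W6: Borgs–Seiler finite-volume Polyakov infrared bound + reflection positivity +
sector Cauchy–Schwarz ⇒ `TwistWindowSU2 204 (9/10)`), and `simplyConnectedSpace_su2` (tree).  RESULT: `not_uniformExit24_holds : ¬ UniformExit24`
— there is NO fixed lattice box `L ≥ 8` whose cold `4:1` purity defect at `SU(2)` stays `≤ 1/24` for all large `β`; equivalently every exit
selector of `E(1/24)` satisfies `L(β) > β/204` eventually (`selector_linear_growth_holds`, all parities).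

WHAT IT IS NOT: the seed `BasinRung.ColdExitAt (1/24)` (∃ selector), K1 `ExitsUnboundedAt (1/24)`, PX, `BalabanLadder.IR` (stmt-QuantumFields-19354)
and `IRcof` (stmt-QuantumFields-26930) are UNTOUCHED — they never owed β-uniformity; this is a WALL (width 0): information on how exits must be
selected.  By the line's finding F5 the statement is GROUP-BLIND (the same architecture applies to `U(1)₄` in real form), so it separates nothing
confining from Coulomb.  The Yang–Mills mass gap (Clay) is NOT proved anywhere in this tree; R4 closes only the conditional finite-𝕋⁴ rung `BalabanLadder.UV`.
-/

set_option autoImplicit false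

noncomputable section

open Filter Topology
open Literature.MathematicalPhysics.QuantumFieldTheory Literature.MathematicalPhysics.QuantumLattice
open Summit.QuantumFields.YangMills.Cruxes.IR.ColdPurityBridge (coldDefect)
open Summit.QuantumFields.YangMills.Theorems.BrascampLiebVacuumSC.Negative (simplyConnectedSpace_su2)

namespace Summit.QuantumFields.YangMills.Theorems.ColdExitSC.Negative.HeavyTwist

/-- **The window of record is a theorem:** `TwistWindowSU2 204 (9/10)`, by name from the wall seat's `HeavyTwistWall.twistWindow_SU2`. -/
theorem twistWindowSU2_holds : TwistWindowSU2 204 (9 / 10) :=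
  Summit.QuantumFields.YangMills.Cruxes.IR.HeavyTwistWall.twistWindow_SU2 minusOneSU2 coe_minusOneSU2

/-- **HEADLINE (unconditional): `¬ UniformExit24`** — the β-uniform exit form of the seed of record at `SU(2)` is false. -/
theorem not_uniformExit24_holds : ¬ UniformExit24 :=
  not_uniformExit24_of_window twistWindowSU2_holds simplyConnectedSpace_su2

/-- The same at every tolerance `0 ≤ θ ≤ 1/24`: `¬ UniformExitAt θ` (unconditional). -/
theorem not_uniformExitAt_holds {θ : ℝ} (hθ0 : 0 ≤ θ) (hθ : θ ≤ 1 / 24) : ¬ UniformExitAt θ :=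
  not_uniformExitAt_of_window twistWindowSU2_holds simplyConnectedSpace_su2 hθ
    (lt_of_le_of_lt (by gcongr) tolerance_of_record_clears)

/-- **Selector form (unconditional):** every exit selector of `E(1/24)` at `SU(2)` has `L(β) > β/204` eventually, ALL parities. -/
theorem selector_linear_growth_holds (Lsel : ℝ → ℕ) (h8 : ∀ᶠ β : ℝ in atTop, 8 ≤ Lsel β)
    (hpure : letI : MeasurableSpace (Matrix.specialUnitaryGroup (Fin 2) ℂ) := borel _
      haveI : BorelSpace (Matrix.specialUnitaryGroup (Fin 2) ℂ) := ⟨rfl⟩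
      ∀ᶠ β : ℝ in atTop, coldDefect (fundamentalLatticeRep 2).ρ β (Lsel β) ≤ 1 / 24) :
    ∀ᶠ β : ℝ in atTop, β / 204 < (Lsel β : ℝ) :=
  selector_linear_growth_of_window twistWindowSU2_holds le_rfl tolerance_of_record_clears Lsel h8 hpure

end Summit.QuantumFields.YangMills.Theorems.ColdExitSC.Negative.HeavyTwist

end
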